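import Mathlib.FieldTheory.Normal.Closure
import Literature.NumberTheory.Automorphic.PatrikisCMDescent
import Literature.NumberTheory.Automorphic.ClozelAlgebraicityConjugatesProofs
import Literature.NumberTheory.Automorphic.AlgebraicityTwist
import Literature.NumberTheory.NumberFields.CMDescentEmbeddings
import HarnessLib

/-!
# Patrikis's CM descent of the infinity type without the model clause: the Hecke stabiliser
# and `Aut(ℂ/ℚ(π_f))` have the same image in every finite Galois group (proofs)

Proofs-only companion (theorems, no definitions, no named facts) of `PatrikisCMDescent.lean`
(named fact `Patrikis2019_cmDescent`: Patrikis 2019, Prop. 2.4.7 with Rem. 2.4.8 (1);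
arXiv:1207.6724 §3.2), companion of `PatrikisCMDescentProofs.lean` (not imported: the two files are
independent proofs of the same reduction, this one with one input fewer).

`PatrikisCMDescentProofs` proves the fact from the named fact `Clozel1990_regularAlgebraic`
(Clozel 1990, Thm. 3.13 (i), (ii), (iv) as vendored in `ClozelAlgebraicity`) and two further
inputs: (a) the MODEL CLAUSE of Clozel's Thm. 3.13 in the form
`Aut(ℂ/ℚ(π_f)) ≤ heckeStabilizer π`, and (b) strong multiplicity one with archimedean
components (Jacquet–Shalika 1981, Thm. 4.4). This file removes input (a) altogether. The point
(a remark in Galois theory, not in the source, which has the model clause available): let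
`H ≤ Aut(ℂ/ℚ)` be ANY subgroup and `E = ℂ^H` its fixed field (for `H = heckeStabilizer π` this
is the tree's `ratField π = ℚ(π_f)`). In general `H ≠ Aut(ℂ/E)` (e.g. `H` = the automorphisms
fixing all but finitely many of `√2, √3, √5, …` has `E = ℚ`), but for every number field `F`
embedded by `j : F → ℂ` and every `σ ∈ Aut(ℂ/E)` some `h ∈ H` agrees with `σ` on `j(F)`:
restrict to the normal closure `N` of `F` in `ℂ` (finite and normal over `ℚ`); the image `H_N`
of `H` in `Aut(N/ℚ)` has fixed field `N ∩ E`, so by Artin's theorem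
(`IntermediateField.fixingSubgroup_fixedField`, `N/ℚ` finite) `H_N = Aut(N / N ∩ E) ∋ σ|_N`.
Hence invariance of the `a`-multisets of an infinity type under `H` is the same as invariance
under `Aut(ℂ/E)`, which is what Patrikis's transitivity argument
(`exists_algEquiv_apply_eq_of_forall_isCMField_or_isTotallyReal`, `CMDescentEmbeddings`)
consumes. For `σ ∈ heckeStabilizer π` the invariance is clause (ii) of Clozel's theorem plus (b),
exactly as in `PatrikisCMDescentProofs` (there for `σ ∈ Aut(ℂ/ℚ(π_f))` via (a)).

Proved here, sorry-free:

* `exists_mem_apply_eq_of_forall_fixed` — the Galois lemma above;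
* `InfinityType.map_a_autConj_eq_of_subgroup_invariance` — `H`-invariance of the `a`-multisets
  of an infinity type implies `Aut(ℂ/ℂ^H)`-invariance;
* `InfinityType.map_a_eq_of_subgroup_invariance` — **Prop. 2.4.7 from `H`-invariance**: if
  `E ⊆ ℂ` is finite over `ℚ`, totally real or CM, and contains `ℂ^H`, and the `a`-multisets of
  `T` are `H`-invariant, they agree at any two embeddings agreeing on every CM-or-totally-real
  subfield of `F`;
* `Clozel1990_regularAlgebraic.map_a_autConj_eq_of_mem_heckeStabilizer` — under
  `Clozel1990_regularAlgebraic` and (b), the `a`-multisets of a regular algebraic infinity type of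
  a cuspidal `π` are invariant under `heckeStabilizer π`;
* `Patrikis2019_cmDescent_of_regularAlgebraic_case` — the fact follows from its regular
  algebraic (C-algebraic) case ("the L-algebraic analogue follows easily by twisting", Patrikis
  Rem. 2.4.8 (1); the twist `π ⊗ |det|^{-(n-1)/2}` is the PROVED
  `CuspidalAutomorphicRepData.exists_twist_hasInfinityType` of `AlgebraicityTwist`), factored
  out of the proof of `Patrikis2019_cmDescent_of_clozel`;
* `Patrikis2019_cmDescent_of_clozel_of_smo` — **the named fact from `Clozel1990_regularAlgebraic`
  and (b) alone**; `Patrikis2019_cmDescent_of_clozel_of_archParameter` — the same with (b) in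
  its archimedean-parameter form (nearly equivalent cuspidal data have equal archimedean
  parameters; for one datum the parameter is unique, `AutomorphicRepData.hasArchParameter_unique`).

What is still NOT proved (why `Patrikis2019_cmDescent_holds` is not here): Clozel's Thm. 3.13
itself (`Clozel1990_regularAlgebraic`, unproved named fact) and (b), strong multiplicity one
for Borel–Jacquet data with the archimedean conclusion (the tree's strong multiplicity one
statements, `strong_multiplicity_one_gl…`, `JacquetShalika_eq_of_rsData_eq`, conclude on Satake
parameters only). Given theorems for these two inputs, `Patrikis2019_cmDescent_holds` is
`Patrikis2019_cmDescent_of_clozel_of_smo` applied to them.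

## References

* S. Patrikis, *Variations on a theorem of Tate*, Mem. AMS 258 (2019), no. 1238
  (= arXiv:1207.6724), §2.4: Clozel's theorem, the Hypothesis, Cor. 2.4.6, Prop. 2.4.7,
  Rem. 2.4.8 (arXiv §3.2: Thm. 3.2.1, Hyp. 3.2.2, Cor. 3.2.3, Prop. `cmdescent`, Rem. 3.2.4).
  [Patrikis2019]
* L. Clozel, *Motifs et formes automorphes*, Perspect. Math. 10 (1990), Thm. 3.13. [Clozel1990]
* H. Jacquet, J. Shalika, *On Euler products and the classification of automorphic forms II*,
  Amer. J. Math. 103 (1981), Thm. 4.4. [JacquetShalika1981]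
* E. Artin, *Galois Theory* (1942), Thm. 14 (`[N : N^G] = |G|`; Mathlib
  `IntermediateField.fixingSubgroup_fixedField`). [folklore]
-/

noncomputable section

open scoped Classical
open NumberField IsDedekindDomain

namespace Literature.NumberTheory.Automorphic

open Literature.NumberTheory.NumberFields

/-! ### A subgroup of `Aut(ℂ)` and the automorphisms fixing its fixed field have the same
restrictions to number fields -/

section Galois

/-- **Galois lemma.** Let `H ≤ Aut(ℂ/ℚ)` be a subgroup and `σ ∈ Aut(ℂ)` an automorphism fixing
the fixed field `ℂ^H` of `H` pointwise. Then for every number field `F` and every embedding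
`j : F → ℂ` some `h ∈ H` agrees with `σ` on `j(F)`. Proof: on the normal closure `N` of `F` in
`ℂ` (finite and normal over `ℚ`, as `ℂ` is algebraically closed) the image `H_N ≤ Aut(N/ℚ)` of `H`
has fixed field `N ∩ ℂ^H`, fixed pointwise by `σ|_N`; by Artin's theorem
(`IntermediateField.fixingSubgroup_fixedField`) `σ|_N ∈ H_N`. (In general `H ≠ Aut(ℂ/ℂ^H)`; only
the images in the finite quotients `Aut(N/ℚ)` agree.) [folklore] -/
theorem exists_mem_apply_eq_of_forall_fixed (H : Subgroup (ℂ ≃ₐ[ℚ] ℂ)) {F : Type*} [Field F]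
    [NumberField F] (j : F →+* ℂ) (σ : ℂ ≃ₐ[ℚ] ℂ)
    (hσ : ∀ z : ℂ, (∀ h ∈ H, h z = z) → σ z = z) :
    ∃ h ∈ H, ∀ x : F, h (j x) = σ (j x) := by
  haveI : Algebra.IsAlgebraic ℚ F := Algebra.IsAlgebraic.of_finite ℚ F
  let N : IntermediateField ℚ ℂ := IntermediateField.normalClosure ℚ F ℂ
  haveI : Normal ℚ N :=
    (Algebra.IsAlgebraic.isNormalClosure_normalClosure (F := ℚ) (K := F) (L := ℂ)
      fun x ↦ IsAlgClosed.splits _).normal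
  have hjN : ∀ x : F, j x ∈ N := fun x ↦
    AlgHom.fieldRange_le_normalClosure j.toRatAlgHom ⟨x, rfl⟩
  let r : (ℂ ≃ₐ[ℚ] ℂ) →* (N ≃ₐ[ℚ] N) := AlgEquiv.restrictNormalHom N
  have hr : ∀ (τ : ℂ ≃ₐ[ℚ] ℂ) (z : N), ((r τ z : N) : ℂ) = τ z := fun τ z ↦
    AlgEquiv.restrictNormal_commutes τ N z
  have hmem : r σ ∈ H.map r := by
    rw [← IntermediateField.fixingSubgroup_fixedField (H.map r),
      IntermediateField.mem_fixingSubgroup_iff]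
    intro z hz
    rw [IntermediateField.mem_fixedField_iff] at hz
    apply Subtype.ext
    rw [hr σ z]
    refine hσ _ fun h hh ↦ ?_
    rw [← hr h z, hz (r h) (Subgroup.mem_map_of_mem r hh)]
  obtain ⟨h, hhH, hh⟩ := Subgroup.mem_map.mp hmem
  refine ⟨h, hhH, fun x ↦ ?_⟩
  have e := congrArg (fun g : N ≃ₐ[ℚ] N ↦ ((g ⟨j x, hjN x⟩ : N) : ℂ)) hh
  simpa only [hr] using e

end Galois

/-! ### Prop. 2.4.7 from invariance under a subgroup with totally real or CM fixed field -/

section Descent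

variable {F : Type} [Field F] [NumberField F] {n : ℕ}

/-- **`H`-invariance is `Aut(ℂ/ℂ^H)`-invariance** for the `a`-multisets of an infinity type:
if `{a of ^hT at ι} = {a of T at ι}` for all `h` in a subgroup `H ≤ Aut(ℂ)` and all `ι`, then
the same holds for every `σ ∈ Aut(ℂ)` fixing `ℂ^H` pointwise (`^σT = T.autConj σ = (ι ↦ T(σ⁻¹ι))`;
pick `h ∈ H` agreeing with `σ⁻¹` on `ι(F)`, `exists_mem_apply_eq_of_forall_fixed`, so that
`T(σ⁻¹ι) = T(hι) = ^{h⁻¹}T(ι)`). [folklore] -/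
theorem InfinityType.map_a_autConj_eq_of_subgroup_invariance (T : InfinityType F n)
    (H : Subgroup (ℂ ≃ₐ[ℚ] ℂ))
    (hT : ∀ h ∈ H, ∀ ι : F →+* ℂ, (T.autConj h ι).map ArchWeight.a = (T ι).map ArchWeight.a)
    (σ : ℂ ≃ₐ[ℚ] ℂ) (hσ : ∀ z : ℂ, (∀ h ∈ H, h z = z) → σ z = z) (ι : F →+* ℂ) :
    (T.autConj σ ι).map ArchWeight.a = (T ι).map ArchWeight.a := by
  have hσ' : ∀ z : ℂ, (∀ h ∈ H, h z = z) → σ.symm z = z := fun z hz ↦ by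
    rw [AlgEquiv.symm_apply_eq]
    exact (hσ z hz).symm
  obtain ⟨h, hhH, hh⟩ := exists_mem_apply_eq_of_forall_fixed H ι σ.symm hσ'
  have e : T.autConj h⁻¹ ι = T.autConj σ ι := by
    simp only [InfinityType.autConj_apply]
    congr 1
    refine RingHom.ext fun x ↦ ?_
    change (h⁻¹).symm (ι x) = σ.symm (ι x)
    rw [AlgEquiv.aut_inv, AlgEquiv.symm_symm]
    exact hh x
  rw [← e]
  exact hT h⁻¹ (inv_mem hhH) ι

/-- **Patrikis 2019, Prop. 2.4.7, from invariance under a subgroup of `Aut(ℂ)`.** Let `T` be an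
infinity type over the number field `F`, `H ≤ Aut(ℂ)` a subgroup under which the `a`-multisets
of `T` are invariant (`{a of ^hT at ι} = {a of T at ι}`, `h ∈ H`; in print `^σπ ≅ π`, hence
`^σM = M`), and `E ⊆ ℂ` a subfield, finite over `ℚ`, totally real or CM, and containing the fixed
field `ℂ^H` (in print `E ⊇ ℚ(π_f)`, CM by Cor. 2.4.6). Then the `a`-multisets of `T` agree at any
two embeddings `ι ι'` of `F` agreeing on every CM-or-totally-real subfield of `F` (i.e. on
`F_cm`): the invariance extends to `Aut(ℂ/E)` (`map_a_autConj_eq_of_subgroup_invariance`), and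
`Aut(ℂ/E)` acts transitively on the embeddings above a fixed embedding of `F_cm`
(`exists_algEquiv_apply_eq_of_forall_isCMField_or_isTotallyReal` of `CMDescentEmbeddings`: some
`σ ∈ Aut(ℂ/E)` has `σι = ι'`, and `μ_{ι'} = μ_{σ⁻¹ι'} = μ_ι`). [cite: Patrikis2019, Prop. 2.4.7 (Mem. AMS numbering; arXiv:1207.6724 §3.2, Prop. `cmdescent`)] -/
theorem InfinityType.map_a_eq_of_subgroup_invariance (T : InfinityType F n)
    (H : Subgroup (ℂ ≃ₐ[ℚ] ℂ)) (E : Subfield ℂ) [FiniteDimensional ℚ E]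
    (hE : IsTotallyReal E ∨ IsCMField E) (hHE : ∀ z : ℂ, (∀ h ∈ H, h z = z) → z ∈ E)
    (hT : ∀ h ∈ H, ∀ ι : F →+* ℂ, (T.autConj h ι).map ArchWeight.a = (T ι).map ArchWeight.a)
    {ι ι' : F →+* ℂ}
    (hιι' : ∀ M : Subfield F, (IsCMField M ∨ IsTotallyReal M) → ∀ x ∈ M, ι x = ι' x) :
    (T ι).map ArchWeight.a = (T ι').map ArchWeight.a := by
  obtain ⟨σ, hσE, hσι⟩ :=
    exists_algEquiv_apply_eq_of_forall_isCMField_or_isTotallyReal E hE ι ι' hιι'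
  -- `σ ∈ Aut(ℂ/E)` with `σ ∘ ι = ι'`, so `^σT` at `ι'` is `T` at `σ⁻¹ι' = ι`
  have hcomp : (σ.symm : ℂ ≃ₐ[ℚ] ℂ).toAlgHom.toRingHom.comp ι' = ι :=
    RingHom.ext fun x ↦ σ.symm_apply_eq.mpr (hσι x).symm
  have h := T.map_a_autConj_eq_of_subgroup_invariance H hT σ
    (fun z hz ↦ hσE z (hHE z hz)) ι'
  rw [InfinityType.autConj_apply, hcomp] at h
  exact h

end Descent

/-! ### The automorphic input: invariance under the Hecke stabiliser from Clozel's theorem and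
strong multiplicity one -/

section Clozel

variable {n : ℕ} {K : Type} [Field K] [NumberField K] {hcpt : isCompact_glFiniteIntegralLevel n K}

/-- **`^σM = M` for `σ` in the Hecke stabiliser** (Patrikis 2019, §2.4: the Hypothesis "`π`
satisfies the conclusion of Clozel's theorem" and the last line of the proof of Prop. 2.4.7),
in the tree's rendering and WITHOUT the model clause. Let `π` be cuspidal on `GL_n(𝔸_K)` with a
regular algebraic infinity type `T`; assume the named fact `Clozel1990_regularAlgebraic` and, for
this `π`, (b) every cuspidal `π'` nearly equivalent to `π` has infinity types with the
`a`-multisets of `T` (strong multiplicity one including the archimedean components,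
Jacquet–Shalika 1981, Thm. 4.4). Then `{a of ^σT at ι} = {a of T at ι}` for every
`σ ∈ heckeStabilizer π` and every `ι`: clause (ii) gives a cuspidal `σ`-conjugate `π'` of `π` with
an infinity type `T'` having the `a`-multisets of `^σT`; `π` is its own `σ`-conjugate
(`mem_heckeStabilizer_iff_isAutConjugate`), so `π'` is nearly equivalent to `π`
(`IsAutConjugate.isNearlyEquivalent`), and (b) identifies the `a`-multisets of `T'` and `T`.
[cite: Patrikis2019, §2.4, Clozel's theorem and the Hypothesis before Cor. 2.4.6 (arXiv:1207.6724 Thm. 3.2.1, Hyp. 3.2.2)] -/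
theorem Clozel1990_regularAlgebraic.map_a_autConj_eq_of_mem_heckeStabilizer
    (hC : Clozel1990_regularAlgebraic) (π : CuspidalAutomorphicRepData n K hcpt)
    {T : InfinityType K n} (hT : π.1.HasInfinityType T) (hreg : T.IsRegularAlgebraic)
    (hsmo : ∀ π' : CuspidalAutomorphicRepData n K hcpt, π.1.IsNearlyEquivalent π'.1 →
      ∀ T' : InfinityType K n, π'.1.HasInfinityType T' →
        ∀ ι : K →+* ℂ, (T ι).map ArchWeight.a = (T' ι).map ArchWeight.a)
    {σ : ℂ ≃ₐ[ℚ] ℂ} (hσ : σ ∈ heckeStabilizer π.1) (ι : K →+* ℂ) :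
    (T.autConj σ ι).map ArchWeight.a = (T ι).map ArchWeight.a := by
  have hself : IsAutConjugate σ π.1 π.1 := (mem_heckeStabilizer_iff_isAutConjugate π.1 σ).mp hσ
  obtain ⟨π', hc', hT'⟩ := hC.exists_autConjugate π ⟨T, hT, hreg⟩ σ
  obtain ⟨T', hT'π, ha⟩ := hT' T hT hreg
  rw [← ha ι]
  exact (hsmo π' (hself.isNearlyEquivalent hc') T' hT'π ι).symm

end Clozel

/-! ### Assembly -/

section Assembly

/-- **Reduction to the regular algebraic case** (Patrikis 2019, Rem. 2.4.8 (1): "the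
L-algebraic analogue follows easily by twisting"). If for every number field `F`, every cuspidal
`π` on `GL_n(𝔸_F)` and every regular algebraic (`IsRegularAlgebraic` = C-algebraic and regular)
infinity type `T` of `π` the `a`-multisets of `T` agree at embeddings agreeing on every
CM-or-totally-real subfield, then `Patrikis2019_cmDescent` holds: for `T` regular and
L-algebraic and `n ≥ 1`, the cuspidal twist `π ⊗ |det|^{-(n-1)/2}`
(`CuspidalAutomorphicRepData.exists_twist_hasInfinityType`) has the regular C-algebraic infinity
type `T.twist (-(n-1)/2)` (`InfinityType.isLAlgebraic_iff_isCAlgebraic_twist`, `IsRegular.twist`),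
whose `a`-multisets are those of `T` shifted (`map_a_twist`); for `n = 0` all multisets are
empty. (The hypothesis "`F` totally imaginary" of the fact is not used.) [cite: Patrikis2019, Rem. 2.4.8 (1) (Mem. AMS numbering; arXiv:1207.6724 Rem. 3.2.4)] -/
theorem Patrikis2019_cmDescent_of_regularAlgebraic_case
    (key : ∀ (F : Type) [Field F] [NumberField F] (n : ℕ)
      (hcpt : isCompact_glFiniteIntegralLevel n F) (π : CuspidalAutomorphicRepData n F hcpt)
      (T : InfinityType F n), π.1.HasInfinityType T → T.IsRegularAlgebraic →
      ∀ ι ι' : F →+* ℂ,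
        (∀ M : Subfield F, (IsCMField M ∨ IsTotallyReal M) → ∀ x ∈ M, ι x = ι' x) →
        (T ι).map ArchWeight.a = (T ι').map ArchWeight.a) :
    Patrikis2019_cmDescent := by
  intro F _ _ _hF n hcpt π T hT hreg halg ι ι' hιι'
  rcases halg with hCalg | hLalg
  · exact key F n hcpt π T hT ⟨hCalg, hreg⟩ ι ι' hιι'
  · rcases Nat.eq_zero_or_pos n with hn | hn
    · -- `n = 0`: all multisets are empty
      subst hn
      have h0 : ∀ ι₀ : F →+* ℂ, T ι₀ = 0 := fun ι₀ ↦ Multiset.card_eq_zero.mp (hT.1.1 ι₀)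
      rw [h0 ι, h0 ι']
    · -- `n ≥ 1`: twist by `|det|^{-(n-1)/2}` to a regular C-algebraic infinity type
      haveI : NeZero n := ⟨hn.ne'⟩
      obtain ⟨χ, π', -, -, -, hT'⟩ := π.exists_twist_hasInfinityType (-(((n : ℝ) - 1) / 2)) hT
      have hC' : (T.twist (((-(((n : ℝ) - 1) / 2) : ℝ) : ℂ))).IsCAlgebraic := by
        have e : (((-(((n : ℝ) - 1) / 2) : ℝ)) : ℂ) = -(((n : ℂ) - 1) / 2) := by
          push_cast
          ring
        rw [e]
        exact (InfinityType.isLAlgebraic_iff_isCAlgebraic_twist T).mp hLalg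
      have h := key F n hcpt π' _ hT' ⟨hC', hreg.twist _⟩ ι ι' hιι'
      rw [InfinityType.map_a_twist, InfinityType.map_a_twist] at h
      exact Multiset.map_injective (add_left_injective _) h

/-- **`Patrikis2019_cmDescent` from Clozel's theorem and strong multiplicity one — no model
clause** (Patrikis 2019, Prop. 2.4.7 with Rem. 2.4.8 (1): "if `π` is regular, this yields an
unconditional descent result for its infinity-type"). Assume `Clozel1990_regularAlgebraic`
(Clozel Thm. 3.13 (i), (ii), (iv)) and (b): on every `GL_n(𝔸_K)`, nearly equivalent cuspidal
representations have infinity types with the same `a`-multisets (Jacquet–Shalika 1981, Thm. 4.4,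
with the archimedean components). Then the fact holds: for `π` cuspidal with a regular algebraic
infinity type `T`, the `a`-multisets of `T` are invariant under `H = heckeStabilizer π`
(`map_a_autConj_eq_of_mem_heckeStabilizer`), `E = ℚ(π_f) = ratField π = ℂ^H` is finite over `ℚ`
(clause (i)) and totally real or CM (clause (iv), Patrikis Cor. 2.4.6), so
`InfinityType.map_a_eq_of_subgroup_invariance` gives the regular algebraic case, and
`Patrikis2019_cmDescent_of_regularAlgebraic_case` the rest. [cite: Patrikis2019, Prop. 2.4.7 and Rem. 2.4.8 (1) (Mem. AMS numbering; arXiv:1207.6724 §3.2)] -/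
theorem Patrikis2019_cmDescent_of_clozel_of_smo (hC : Clozel1990_regularAlgebraic)
    (hsmo : ∀ (n : ℕ) (K : Type) [Field K] [NumberField K]
      (hcpt : isCompact_glFiniteIntegralLevel n K) (π π' : CuspidalAutomorphicRepData n K hcpt),
      π.1.IsNearlyEquivalent π'.1 → ∀ T T' : InfinityType K n,
        π.1.HasInfinityType T → π'.1.HasInfinityType T' →
          ∀ ι : K →+* ℂ, (T ι).map ArchWeight.a = (T' ι).map ArchWeight.a) :
    Patrikis2019_cmDescent := by
  refine Patrikis2019_cmDescent_of_regularAlgebraic_case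
    fun F _ _ n hcpt π T hT hreg ι ι' hιι' ↦ ?_
  have hπ : π.1.IsRegularAlgebraic := ⟨T, hT, hreg⟩
  haveI : FiniteDimensional ℚ (ratField π.1).toSubfield := hC.finiteDimensional_ratField π hπ
  exact T.map_a_eq_of_subgroup_invariance (heckeStabilizer π.1) (ratField π.1).toSubfield
    (hC.isTotallyReal_or_isCMField π hπ) (fun z hz ↦ (mem_ratField_iff π.1 z).mpr hz)
    (fun σ hσ ι₀ ↦ hC.map_a_autConj_eq_of_mem_heckeStabilizer π hT hreg
      (fun π' hne T' hT' ↦ hsmo n F hcpt π π' hne T T' hT hT') hσ ι₀)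
    hιι'

/-- **`Patrikis2019_cmDescent` from Clozel's theorem and strong multiplicity one in its
archimedean-parameter form.** As `Patrikis2019_cmDescent_of_clozel_of_smo`, with (b) stated on
archimedean parameters: nearly equivalent cuspidal representations of `GL_n(𝔸_K)` have equal
archimedean parameters (`AutomorphicRepData.HasArchParameter`; Jacquet–Shalika 1981, Thm. 4.4:
they are isomorphic, in particular at the archimedean places; for one datum the parameter is
unique, `AutomorphicRepData.hasArchParameter_unique`). An infinity type `T` of `π` carries the
archimedean parameter `ι ↦ {a of T at ι}` (`HasInfinityType`), so this form implies the
multiset form. [cite: Patrikis2019, Prop. 2.4.7 and Rem. 2.4.8 (1) (Mem. AMS numbering; arXiv:1207.6724 §3.2)] -/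
theorem Patrikis2019_cmDescent_of_clozel_of_archParameter (hC : Clozel1990_regularAlgebraic)
    (harch : ∀ (n : ℕ) (K : Type) [Field K] [NumberField K]
      (hcpt : isCompact_glFiniteIntegralLevel n K) (π π' : CuspidalAutomorphicRepData n K hcpt),
      π.1.IsNearlyEquivalent π'.1 → ∀ χ χ' : (K →+* ℂ) → Multiset ℂ,
        π.1.HasArchParameter χ → π'.1.HasArchParameter χ' → χ = χ') :
    Patrikis2019_cmDescent :=
  Patrikis2019_cmDescent_of_clozel_of_smo hC fun n K _ _ hcpt π π' hne _ _ hT hT' ι ↦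
    congrFun (harch n K hcpt π π' hne _ _ hT.2 hT'.2) ι

end Assembly

end Literature.NumberTheory.Automorphic
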